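import Mathlib

/-!
# Combinatorial core of Hodge classes on CM abelian varieties (cell pub-hodge-repro0, seat p8)

Let `A` be a complex abelian variety of dimension `g` with a CM algebra `E ⊂ End⁰(A)` of degree
`2g`, `X := Hom(E, ℚ̄)` (so `|X| = 2g`), `ι : X → X` the fixed-point-free involution `σ ↦ σ ∘ ρ`
(`ρ` = complex conjugation of `E`), and `Φ ⊂ X` the CM type of `A`.  For every `τ ∈ Gal(ℚ̄/ℚ)` the
translate `τΦ` is again an `ι`-transversal of `X`.  The paper analysis
`proofs/p8-lefschetz-analysis.md` (C1) shows that the ℚ̄-span of the rational Hodge classes of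
codimension `p` on `A` is the sum of the lines `L_S` over the *Hodge sets* `S ⊂ X`, `|S| = 2p`,
`|S ∩ τΦ| = p` for all `τ`; (C2) that the pairs `{σ, ισ}` are Hodge sets and that the
divisor-generated classes correspond to disjoint unions of two-element Hodge sets; (C3) that if every
Hodge set is such a disjoint union then the Hodge conjecture holds for `A`; (C4) that this is the
case when the CM type is *nondegenerate*, i.e. the vectors `1_{τΦ} − 1_{ιτΦ}` span the
`ι`-anti-invariant functions on `X`.

This file certifies the purely combinatorial content of (C2)(i) and (C4): for abstract data
`(X, ι, (T γ)_γ)` with each `T γ` an `ι`-transversal,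

* `CMTypeData.pair_isHodgeSet`: every pair `{x, ι x}` is a Hodge set;
* `CMTypeData.isHodgeSet_of_pairDecomposable`: disjoint unions of two-element Hodge sets are Hodge
  sets;
* `CMTypeData.stable_of_isHodgeSet_of_nondegenerate`: if the data is nondegenerate, every Hodge set
  is `ι`-stable;
* `CMTypeData.pairDecomposable_of_isHodgeSet_of_nondegenerate`: hence pair-decomposable.

No Hodge theory is formalised here: the bridge from abelian varieties to this data is the paper
statement (C1)–(C3).
-/

namespace HodgeRepro0.CMCombinatorics

open Finset

/-- The combinatorial data of a CM type: a finite set `X` of "embeddings", a fixed-point-free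
involution `ι` on `X` ("complex conjugation"), and a family `T : Γ → Finset X` of "CM types"
(think: the Galois translates `τΦ`), each of which is a transversal of `ι`, i.e. contains exactly one
element of every pair `{x, ι x}`. -/
structure CMTypeData (X : Type*) (Γ : Type*) where
  /-- the involution `σ ↦ σ ∘ ρ` on the set of embeddings -/
  ι : X → X
  /-- `ι` is an involution -/
  ι_ι : ∀ x, ι (ι x) = x
  /-- `ι` has no fixed point -/
  ι_ne : ∀ x, ι x ≠ x
  /-- the CM types `τΦ`, indexed by `γ : Γ` -/
  T : Γ → Finset X
  /-- each `T γ` is an `ι`-transversal -/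
  mem_T_iff : ∀ γ x, x ∈ T γ ↔ ι x ∉ T γ

/-- The `ℚ`-valued indicator function of a finite set. -/
def ind {X : Type*} [DecidableEq X] (S : Finset X) : X → ℚ := fun x => if x ∈ S then 1 else 0

namespace CMTypeData

variable {X : Type*} [DecidableEq X] {Γ : Type*} (D : CMTypeData X Γ)

/-- `S` is a *Hodge set*: `|S ∩ T γ| = |S| / 2` for every `γ`. -/
def IsHodgeSet (S : Finset X) : Prop := ∀ γ, 2 * (S ∩ D.T γ).card = S.card

/-- The pair `{x, ι x}`. -/
def pair (x : X) : Finset X := {x, D.ι x}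

/-- The pair `{x, ι x}` has two elements. -/
lemma card_pair (x : X) : (D.pair x).card = 2 := by
  unfold pair
  exact Finset.card_pair (D.ι_ne x).symm

/-- `{ι x, ι ι x} = {x, ι x}`. -/
lemma pair_iota (x : X) : D.pair (D.ι x) = D.pair x := by
  unfold pair
  rw [D.ι_ι]
  exact Finset.pair_comm _ _

/-- Two pairs sharing an element coincide. -/
lemma pair_eq_of_mem {x y z : X} (hx : z ∈ D.pair x) (hy : z ∈ D.pair y) :
    D.pair x = D.pair y := by
  simp only [pair, Finset.mem_insert, Finset.mem_singleton] at hx hy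
  rcases hx with hx | hx <;> rcases hy with hy | hy
  · rw [← hx, ← hy]
  · rw [← hx, hy, D.pair_iota]
  · rw [← hy, hx, D.pair_iota]
  · have hxy : x = y := by rw [← D.ι_ι x, ← hx, hy, D.ι_ι]
    rw [hxy]

/-- Every pair `{x, ι x}` is a Hodge set: each CM type `T γ` contains exactly one of `x`, `ι x`. -/
lemma pair_isHodgeSet (x : X) : D.IsHodgeSet (D.pair x) := by
  intro γ
  rw [D.card_pair]
  have key : (D.pair x ∩ D.T γ).card = 1 := by
    by_cases hx : x ∈ D.T γ
    · have hix : D.ι x ∉ D.T γ := (D.mem_T_iff γ x).1 hx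
      have : D.pair x ∩ D.T γ = {x} := by
        ext y
        simp only [pair, Finset.mem_inter, Finset.mem_insert, Finset.mem_singleton]
        constructor
        · rintro ⟨h1 | h1, h2⟩
          · exact h1
          · exact absurd (h1 ▸ h2) hix
        · rintro rfl
          exact ⟨Or.inl rfl, hx⟩
      rw [this, Finset.card_singleton]
    · have hix : D.ι x ∈ D.T γ := by
        by_contra h
        exact hx ((D.mem_T_iff γ x).2 h)
      have : D.pair x ∩ D.T γ = {D.ι x} := by
        ext y
        simp only [pair, Finset.mem_inter, Finset.mem_insert, Finset.mem_singleton]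
        constructor
        · rintro ⟨h1 | h1, h2⟩
          · exact absurd (h1 ▸ h2) hx
          · exact h1
        · rintro rfl
          exact ⟨Or.inr rfl, hix⟩
      rw [this, Finset.card_singleton]
  omega

/-- `S` is *pair-decomposable*: a disjoint union of two-element Hodge sets. -/
def PairDecomposable (S : Finset X) : Prop :=
  ∃ P : Finset (Finset X), (∀ Q ∈ P, Q.card = 2 ∧ D.IsHodgeSet Q) ∧
    (P : Set (Finset X)).PairwiseDisjoint id ∧ P.biUnion id = S

/-- A disjoint union of Hodge sets is a Hodge set; in particular pair-decomposable sets are Hodge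
sets. -/
lemma isHodgeSet_of_pairDecomposable {S : Finset X} (h : D.PairDecomposable S) :
    D.IsHodgeSet S := by
  obtain ⟨P, hP, hdisj, rfl⟩ := h
  intro γ
  have hd : ∀ Q ∈ P, ∀ Q' ∈ P, Q ≠ Q' → Disjoint (id Q) (id Q') :=
    fun Q hQ Q' hQ' hne => hdisj hQ hQ' hne
  have hd' : ∀ Q ∈ P, ∀ Q' ∈ P, Q ≠ Q' → Disjoint (id Q ∩ D.T γ) (id Q' ∩ D.T γ) :=
    fun Q hQ Q' hQ' hne =>
      (hd Q hQ Q' hQ' hne).mono Finset.inter_subset_left Finset.inter_subset_left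
  rw [Finset.biUnion_inter, Finset.card_biUnion hd', Finset.card_biUnion hd, Finset.mul_sum]
  exact Finset.sum_congr rfl fun Q hQ => (hP Q hQ).2 γ

/-- An `ι`-stable set is pair-decomposable: `S = ⋃_{x ∈ S} {x, ι x}`. -/
lemma pairDecomposable_of_stable {S : Finset X} (hS : ∀ x, x ∈ S → D.ι x ∈ S) :
    D.PairDecomposable S := by
  refine ⟨S.image D.pair, ?_, ?_, ?_⟩
  · intro Q hQ
    obtain ⟨x, -, rfl⟩ := Finset.mem_image.1 hQ
    exact ⟨D.card_pair x, D.pair_isHodgeSet x⟩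
  · intro Q hQ Q' hQ' hne
    obtain ⟨x, -, rfl⟩ := Finset.mem_image.1 (Finset.mem_coe.1 hQ)
    obtain ⟨y, -, rfl⟩ := Finset.mem_image.1 (Finset.mem_coe.1 hQ')
    change Disjoint (D.pair x) (D.pair y)
    rw [Finset.disjoint_left]
    intro z hz hz'
    exact hne (D.pair_eq_of_mem hz hz')
  · ext z
    simp only [Finset.mem_biUnion, Finset.mem_image, id]
    constructor
    · rintro ⟨Q, ⟨x, hx, rfl⟩, hz⟩
      simp only [pair, Finset.mem_insert, Finset.mem_singleton] at hz
      rcases hz with rfl | rfl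
      · exact hx
      · exact hS x hx
    · intro hz
      exact ⟨D.pair z, ⟨z, hz, rfl⟩, by simp [pair]⟩

section Nondegenerate

variable [Fintype X]

/-- The anti-invariant vector `f_γ = 1_{T γ} − 1_{ι (T γ)}` attached to the CM type `T γ`
(note `x ∈ ι (T γ) ↔ ι x ∈ T γ`). -/
def fvec (γ : Γ) : X → ℚ :=
  fun x => (if x ∈ D.T γ then 1 else 0) - (if D.ι x ∈ D.T γ then 1 else 0)

/-- *Nondegeneracy* of the CM type data: the vectors `f_γ` span the space of `ι`-anti-invariant
functions `X → ℚ` (this is "Kubota rank `g + 1`"; see (C4) of the paper analysis). -/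
def Nondegenerate : Prop :=
  ∀ h : X → ℚ, (∀ x, h (D.ι x) = - h x) → h ∈ Submodule.span ℚ (Set.range D.fvec)

/-- For a Hodge set `S`, the indicator of `S` is orthogonal to every `f_γ`:
`⟨1_S, f_γ⟩ = |S ∩ T γ| − |S ∖ T γ| = 0`. -/
lemma ind_dotProduct_fvec {S : Finset X} (hS : D.IsHodgeSet S) (γ : Γ) :
    ind S ⬝ᵥ D.fvec γ = 0 := by
  have hc : (S.filter (fun x => D.ι x ∈ D.T γ)).card + (S ∩ D.T γ).card = S.card := by
    have e : S.filter (fun x => D.ι x ∈ D.T γ) = S.filter (fun x => ¬ x ∈ D.T γ) := by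
      apply Finset.filter_congr
      intro x _
      rw [D.mem_T_iff γ x, not_not]
    rw [e, ← Finset.filter_mem_eq_inter, add_comm, Finset.card_filter_add_card_filter_not]
  have hS' := hS γ
  have hcard : (S.filter (fun x => D.ι x ∈ D.T γ)).card = (S ∩ D.T γ).card := by omega
  simp only [dotProduct, ind, fvec, boole_mul]
  rw [Finset.sum_ite_mem, Finset.univ_inter, Finset.sum_sub_distrib, Finset.sum_boole,
    Finset.sum_boole, Finset.filter_mem_eq_inter, hcard, sub_self]

omit [DecidableEq X] in
/-- Reindexing a sum over `X` by the involution `ι`. -/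
lemma sum_comp_iota (g : X → ℚ) : ∑ x, g (D.ι x) = ∑ x, g x :=
  Equiv.sum_comp (Function.Involutive.toPerm D.ι D.ι_ι) g

/-- **Nondegenerate ⇒ every Hodge set is `ι`-stable.**  Proof: `f := 1_S` is orthogonal to the
span of the `f_γ`, which by nondegeneracy contains the anti-invariant vector `h := f − f ∘ ι`; so
`⟨f, h⟩ = 0`, whence `⟨h, h⟩ = 2⟨f, h⟩ = 0` (reindex by `ι`), so `h = 0`, i.e. `1_S = 1_S ∘ ι`. -/
theorem stable_of_isHodgeSet_of_nondegenerate (hD : D.Nondegenerate) {S : Finset X}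
    (hS : D.IsHodgeSet S) : ∀ x, x ∈ S ↔ D.ι x ∈ S := by
  set f : X → ℚ := ind S with hf
  let φ : (X → ℚ) →ₗ[ℚ] ℚ :=
    { toFun := fun g => f ⬝ᵥ g
      map_add' := fun g g' => dotProduct_add f g g'
      map_smul' := fun c g => by simp [dotProduct_smul] }
  have hker : Submodule.span ℚ (Set.range D.fvec) ≤ LinearMap.ker φ := by
    rw [Submodule.span_le]
    rintro _ ⟨γ, rfl⟩
    simp only [SetLike.mem_coe, LinearMap.mem_ker]
    exact D.ind_dotProduct_fvec hS γ
  set h : X → ℚ := fun x => f x - f (D.ι x) with hh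
  have hanti : ∀ x, h (D.ι x) = - h x := by
    intro x
    simp only [hh, D.ι_ι]
    ring
  have hmem : h ∈ Submodule.span ℚ (Set.range D.fvec) := hD h hanti
  have hφ : f ⬝ᵥ h = 0 := LinearMap.mem_ker.1 (hker hmem)
  have A : ∑ x, f (D.ι x) * f (D.ι x) = ∑ x, f x * f x := D.sum_comp_iota (fun x => f x * f x)
  have L : ∑ x, (f x - f (D.ι x)) * (f x - f (D.ι x))
      = ∑ x, f x * f x - 2 * ∑ x, f x * f (D.ι x) + ∑ x, f (D.ι x) * f (D.ι x) := by
    rw [Finset.mul_sum, ← Finset.sum_sub_distrib, ← Finset.sum_add_distrib]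
    exact Finset.sum_congr rfl (fun x _ => by ring)
  have R : ∑ x, f x * (f x - f (D.ι x)) = ∑ x, f x * f x - ∑ x, f x * f (D.ι x) := by
    rw [← Finset.sum_sub_distrib]
    exact Finset.sum_congr rfl (fun x _ => by ring)
  have hhh : h ⬝ᵥ h = 2 * (f ⬝ᵥ h) := by
    simp only [dotProduct, hh]
    rw [L, R, A]
    ring
  have h0 : h ⬝ᵥ h = 0 := by rw [hhh, hφ, mul_zero]
  have hz : h = 0 := dotProduct_self_eq_zero.1 h0
  intro x
  have hx : f x = f (D.ι x) := by
    have := congrFun hz x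
    simp only [hh, Pi.zero_apply, sub_eq_zero] at this
    exact this
  simp only [hf, ind] at hx
  by_cases h1 : x ∈ S <;> by_cases h2 : D.ι x ∈ S <;> simp [h1, h2] at hx ⊢

/-- **Nondegenerate ⇒ every Hodge set is pair-decomposable** (the combinatorial content of (C4)). -/
theorem pairDecomposable_of_isHodgeSet_of_nondegenerate (hD : D.Nondegenerate) {S : Finset X}
    (hS : D.IsHodgeSet S) : D.PairDecomposable S :=
  D.pairDecomposable_of_stable fun x hx => (D.stable_of_isHodgeSet_of_nondegenerate hD hS x).1 hx

end Nondegenerate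

section OfCMType

open scoped Pointwise

/-- The data attached to a CM type `Φ ⊂ X` and a group `G` acting on `X` and commuting with `ι`
(think `G = Gal(ℚ̄/ℚ)`, acting on `X = Hom(E, ℚ̄)`): the CM types are the translates `T g = g • Φ`. -/
def ofCMType {G : Type*} [Group G] [MulAction G X] (ι : X → X) (hι : ∀ x, ι (ι x) = x)
    (hne : ∀ x, ι x ≠ x) (hcomm : ∀ (g : G) (x : X), g • ι x = ι (g • x)) (Φ : Finset X)
    (hΦ : ∀ x, x ∈ Φ ↔ ι x ∉ Φ) : CMTypeData X G where
  ι := ι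
  ι_ι := hι
  ι_ne := hne
  T g := g • Φ
  mem_T_iff g x := by
    rw [← Finset.inv_smul_mem_iff, ← Finset.inv_smul_mem_iff, hΦ (g⁻¹ • x), hcomm]

end OfCMType

end CMTypeData

/-- Non-vacuity witness: `X = Bool`, `ι = not`, a single CM type `{true}`. -/
def boolData : CMTypeData Bool Unit where
  ι := not
  ι_ι := Bool.not_not
  ι_ne := fun x => by cases x <;> decide
  T _ := {true}
  mem_T_iff _ x := by cases x <;> decide

/-- The witness `boolData` is nondegenerate: every anti-invariant `h : Bool → ℚ` is
`h true • f_()`. -/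
theorem boolData_nondegenerate : boolData.Nondegenerate := by
  intro h hh
  have e : h = h true • boolData.fvec () := by
    funext x
    cases x
    · have h1 : h false = - h true := hh true
      simp [boolData, CMTypeData.fvec, h1]
    · simp [boolData, CMTypeData.fvec]
  rw [e]
  exact Submodule.smul_mem _ _ (Submodule.subset_span ⟨(), rfl⟩)

end HodgeRepro0.CMCombinatorics
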